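import Mathlib.Analysis.Convolution
import Mathlib.Analysis.Calculus.ContDiff.Convolution
import Mathlib.Analysis.Calculus.BumpFunction.Convolution
import Mathlib.Analysis.Calculus.BumpFunction.FiniteDimension
import Literature.Analysis.Complex.HormanderWeightedIdentity
import Literature.Analysis.FunctionSpaces.MollificationLp
import HarnessLib

/-!
# Friedrichs mollification and the Wirtinger operators on `ℂ^ι`

Layer `Literature/Analysis/Complex`; Euclidean support file for the density lemma (Hörmander,
*An Introduction to Complex Analysis in Several Variables* (1973), Lemma 4.1.3, proof, p. 80–81:
«if `f ∈ D_{T*} ∩ D_S` has compact support … `S(f ⋆ χ_ε) = (Sf) ⋆ χ_ε`, … the convolution with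
`χ_ε` commutes with first-order constant-coefficient operators …», i.e. Friedrichs' lemma in the
elementary constant-coefficient case).

For a real `C^∞` kernel `ρ` with compact support on `ℂ^ι = ι → ℂ` (Lebesgue measure `volume`) and a
locally integrable `u : ℂ^ι → ℂ`, the mollification `ρ ⋆ u = ρ ⋆[lsmul ℝ ℝ, volume] u` is `C^∞` and

* `dbarAlong_convolution` / `delAlong_convolution`:
  `∂̄_v (ρ ⋆ u)(x) = -∫ u(y) ∂̄_v[ρ(x - ·)](y) dy`, `∂_v (ρ ⋆ u)(x) = -∫ u(y) ∂_v[ρ(x - ·)](y) dy`;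
* `dbarAlong_convolution_sub_eq` : if `∫ (F₂ ∂̄_a W - F₁ ∂̄_b W) = -∫ S W` for all complex test
  functions `W`, then `∂̄_a (ρ ⋆ F₂) - ∂̄_b (ρ ⋆ F₁) = ρ ⋆ S` pointwise;
* `sum_delAlong_convolution_eq` : if `∫ ∑_i F_i ∂_{v_i} W = -∫ H W` for all test `W`, then
  `∑_i ∂_{v_i} (ρ ⋆ F_i) = ρ ⋆ H` pointwise

(«mollification commutes with constant-coefficient first-order operators in the weak sense»).
The one-real-derivative case is the tree's `FunctionSpaces.HasWeakFDerivOn.hasFDerivAt_convolution`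
(`Mollification.lean`), whose proof we follow (Mathlib's `HasCompactSupport.hasFDerivAt_convolution_left`
and the change of variables `y = x - t`).

## References

* L. Hörmander, *An Introduction to Complex Analysis in Several Variables* (1973), Lemma 4.1.3 (proof),
  p. 80–81. [HormanderSCV1973]
* L. C. Evans, *Partial Differential Equations*, 2nd ed. (2010), §5.3.1 Thm. 1. [Evans2010]

#harness_tags complex_analysis.several_variables, analysis.mollification, complex_analysis.l2_estimates
-/

noncomputable section

open scoped ContDiff Topology ComplexConjugate Convolution
open Set Filter Function Complex MeasureTheory ContinuousLinearMap

namespace Literature.Analysis.Complex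

namespace WirtingerMollification

variable {ι : Type} [Fintype ι]

variable {ρ : (ι → ℂ) → ℝ} {u : (ι → ℂ) → ℂ}

/-! ### The mollification and its first derivatives -/

/-- The mollification of a locally integrable function by a `C^n` compactly supported kernel is
`C^n`. [folklore] -/
theorem contDiff_convolution {n : ℕ∞} (hρ : ContDiff ℝ n ρ) (hρc : HasCompactSupport ρ)
    (hu : LocallyIntegrable u volume) : ContDiff ℝ n (ρ ⋆[lsmul ℝ ℝ, volume] u) :=
  hρc.contDiff_convolution_left _ hρ hu

/-- The mollification as an integral against the reflected kernel:
`(ρ ⋆ u)(x) = ∫ u(y) ρ(x - y) dy`. [folklore] -/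
theorem convolution_eq_integral (ρ : (ι → ℂ) → ℝ) (u : (ι → ℂ) → ℂ) (x : ι → ℂ) :
    (ρ ⋆[lsmul ℝ ℝ, volume] u) x = ∫ y, u y * (ρ (x - y) : ℂ) := by
  rw [convolution_def, ← integral_sub_left_eq_self (fun t ↦ lsmul ℝ ℝ (ρ t) (u (x - t))) volume x]
  refine integral_congr_ae (ae_of_all _ fun y ↦ ?_)
  simp only [sub_sub_cancel, lsmul_apply, real_smul]
  ring

/-- **Derivative of the mollification**: `D(ρ ⋆ u)(x) v = ∫ Dρ(x - y) v · u(y) dy` for a `C¹`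
compactly supported kernel and locally integrable `u`. [cite: Evans2010, §5.3.1 Thm. 1] -/
theorem fderiv_convolution_apply (hρ : ContDiff ℝ 1 ρ) (hρc : HasCompactSupport ρ)
    (hu : LocallyIntegrable u volume) (x v : ι → ℂ) :
    fderiv ℝ (ρ ⋆[lsmul ℝ ℝ, volume] u) x v = ∫ y, (fderiv ℝ ρ (x - y) v : ℂ) * u y := by
  have hD := hρc.hasFDerivAt_convolution_left (lsmul ℝ ℝ) hρ hu x
  rw [hD.fderiv]
  have hint : ConvolutionExistsAt (fderiv ℝ ρ) u x ((lsmul ℝ ℝ : ℝ →L[ℝ] ℂ →L[ℝ] ℂ).precompL (ι → ℂ)) volume :=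
    (hρc.fderiv ℝ).convolutionExists_left _ (hρ.continuous_fderiv one_ne_zero) hu x
  rw [convolution_def, ContinuousLinearMap.integral_apply hint.integrable v]
  simp only [precompL_apply, lsmul_apply]
  rw [← integral_sub_left_eq_self (fun t ↦ (fderiv ℝ ρ t v) • u (x - t)) volume x]
  refine integral_congr_ae (ae_of_all _ fun y ↦ ?_)
  simp only [sub_sub_cancel, real_smul]

/-! ### The reflected kernel as a complex test function -/

/-- The reflected kernel `y ↦ ρ(x - y)`, read in `ℂ`, is `C^n`. [folklore] -/
theorem contDiff_ofReal_comp_sub {n : ℕ∞} (hρ : ContDiff ℝ n ρ) (x : ι → ℂ) :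
    ContDiff ℝ n fun y ↦ (ρ (x - y) : ℂ) :=
  ofRealCLM.contDiff.comp (hρ.comp (contDiff_const.sub contDiff_id))

omit [Fintype ι] in
/-- The reflected kernel has compact support. [folklore] -/
theorem hasCompactSupport_ofReal_comp_sub (hρc : HasCompactSupport ρ) (x : ι → ℂ) :
    HasCompactSupport fun y ↦ (ρ (x - y) : ℂ) :=
  (hρc.comp_homeomorph (Homeomorph.subLeft x)).comp_left ofReal_zero

/-- Support of the reflected kernel: `tsupport (ρ(x - ·)) ⊆ x - tsupport ρ`; in particular it lies
in `closedBall x R` when `tsupport ρ ⊆ closedBall 0 R`. [folklore] -/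
theorem tsupport_ofReal_comp_sub_subset {R : ℝ} (hR : tsupport ρ ⊆ Metric.closedBall 0 R) (x : ι → ℂ) :
    tsupport (fun y ↦ (ρ (x - y) : ℂ)) ⊆ Metric.closedBall x R := by
  refine closure_minimal (fun y hy ↦ ?_) Metric.isClosed_closedBall
  have hy' : ρ (x - y) ≠ 0 := by simpa [mem_support] using hy
  have hmem : x - y ∈ Metric.closedBall (0 : ι → ℂ) R := hR (subset_tsupport _ (mem_support.2 hy'))
  rw [Metric.mem_closedBall, dist_zero_right] at hmem
  rw [Metric.mem_closedBall, dist_comm, dist_eq_norm]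
  exact hmem

/-- Derivative of the reflected kernel: `D[ρ(x - ·)](y) v = -Dρ(x - y) v` (in `ℂ`). [folklore] -/
theorem fderiv_ofReal_comp_sub_apply (hρ : ContDiff ℝ 1 ρ) (x y v : ι → ℂ) :
    fderiv ℝ (fun y ↦ (ρ (x - y) : ℂ)) y v = -(fderiv ℝ ρ (x - y) v : ℂ) := by
  have h1 : HasFDerivAt (fun z : ι → ℂ ↦ x - z) (-ContinuousLinearMap.id ℝ (ι → ℂ)) y :=
    (hasFDerivAt_id y).const_sub x
  have h2 : HasFDerivAt ρ (fderiv ℝ ρ (x - y)) (x - y) := ((hρ.differentiable one_ne_zero) _).hasFDerivAt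
  have h3 : HasFDerivAt (fun y ↦ (ρ (x - y) : ℂ)) (ofRealCLM.comp ((fderiv ℝ ρ (x - y)).comp
      (-ContinuousLinearMap.id ℝ (ι → ℂ)))) y :=
    ofRealCLM.hasFDerivAt.comp y (h2.comp y h1)
  rw [h3.fderiv]
  simp

/-- `∂̄_v` of the reflected kernel in terms of `Dρ`. [folklore] -/
theorem dbarAlong_ofReal_comp_sub (hρ : ContDiff ℝ 1 ρ) (x y v : ι → ℂ) :
    dbarAlong v (fun y ↦ (ρ (x - y) : ℂ)) y =
      -((2 : ℂ)⁻¹ * ((fderiv ℝ ρ (x - y) v : ℂ) + I * (fderiv ℝ ρ (x - y) (I • v) : ℂ))) := by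
  rw [dbarAlong_apply, fderiv_ofReal_comp_sub_apply hρ, fderiv_ofReal_comp_sub_apply hρ, smul_eq_mul, smul_eq_mul]
  ring

/-- `∂_v` of the reflected kernel in terms of `Dρ`. [folklore] -/
theorem delAlong_ofReal_comp_sub (hρ : ContDiff ℝ 1 ρ) (x y v : ι → ℂ) :
    delAlong v (fun y ↦ (ρ (x - y) : ℂ)) y =
      -((2 : ℂ)⁻¹ * ((fderiv ℝ ρ (x - y) v : ℂ) - I * (fderiv ℝ ρ (x - y) (I • v) : ℂ))) := by
  rw [delAlong_apply, fderiv_ofReal_comp_sub_apply hρ, fderiv_ofReal_comp_sub_apply hρ, smul_eq_mul, smul_eq_mul]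
  ring

/-- Integrability of `u · g` for `u` locally integrable and `g` continuous with compact support.
[folklore] -/
theorem integrable_mul_of_hasCompactSupport (hu : LocallyIntegrable u volume) {g : (ι → ℂ) → ℂ}
    (hg : Continuous g) (hgc : HasCompactSupport g) : Integrable (fun y ↦ u y * g y) volume :=
  hu.integrable_smul_right_of_hasCompactSupport hg hgc

/-- Integrability of `Dρ(x - ·) v · u`. [folklore] -/
theorem integrable_fderiv_comp_sub_mul (hρ : ContDiff ℝ 1 ρ) (hρc : HasCompactSupport ρ)
    (hu : LocallyIntegrable u volume) (x v : ι → ℂ) :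
    Integrable (fun y ↦ (fderiv ℝ ρ (x - y) v : ℂ) * u y) volume := by
  have hc : Continuous fun y ↦ (fderiv ℝ ρ (x - y) v : ℂ) :=
    continuous_ofReal.comp (((hρ.continuous_fderiv one_ne_zero).comp (continuous_const.sub continuous_id)).clm_apply
      continuous_const)
  have hs : HasCompactSupport fun y ↦ (fderiv ℝ ρ (x - y) v : ℂ) := by
    have h1 : HasCompactSupport fun y ↦ fderiv ℝ ρ (x - y) := (hρc.fderiv ℝ).comp_homeomorph (Homeomorph.subLeft x)
    have h2 : HasCompactSupport fun y ↦ fderiv ℝ ρ (x - y) v := h1.mono fun y hy ↦ by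
      rw [mem_support] at hy ⊢
      intro h0; apply hy
      simp [h0]
    exact h2.comp_left ofReal_zero
  have := hu.integrable_smul_left_of_hasCompactSupport hc hs
  simpa only [smul_eq_mul] using this

/-- **`∂̄_v` of a mollification**: `∂̄_v (ρ ⋆ u)(x) = -∫ u(y) ∂̄_v[ρ(x - ·)](y) dy`.
[cite: HormanderSCV1973, Lemma 4.1.3 (proof, p. 80)] -/
theorem dbarAlong_convolution (hρ : ContDiff ℝ 1 ρ) (hρc : HasCompactSupport ρ)
    (hu : LocallyIntegrable u volume) (x v : ι → ℂ) :
    dbarAlong v (ρ ⋆[lsmul ℝ ℝ, volume] u) x = -∫ y, u y * dbarAlong v (fun y ↦ (ρ (x - y) : ℂ)) y := by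
  rw [dbarAlong_apply, fderiv_convolution_apply hρ hρc hu, fderiv_convolution_apply hρ hρc hu, smul_eq_mul, smul_eq_mul]
  simp_rw [dbarAlong_ofReal_comp_sub hρ]
  have h1 := integrable_fderiv_comp_sub_mul hρ hρc hu x v
  have h2 := integrable_fderiv_comp_sub_mul hρ hρc hu x (I • v)
  rw [← integral_const_mul, ← integral_add h1 (h2.const_mul I), ← integral_const_mul, ← integral_neg]
  refine integral_congr_ae (ae_of_all _ fun y ↦ ?_)
  ring

/-- **`∂_v` of a mollification**: `∂_v (ρ ⋆ u)(x) = -∫ u(y) ∂_v[ρ(x - ·)](y) dy`.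
[cite: HormanderSCV1973, Lemma 4.1.3 (proof, p. 80)] -/
theorem delAlong_convolution (hρ : ContDiff ℝ 1 ρ) (hρc : HasCompactSupport ρ)
    (hu : LocallyIntegrable u volume) (x v : ι → ℂ) :
    delAlong v (ρ ⋆[lsmul ℝ ℝ, volume] u) x = -∫ y, u y * delAlong v (fun y ↦ (ρ (x - y) : ℂ)) y := by
  rw [delAlong_apply, fderiv_convolution_apply hρ hρc hu, fderiv_convolution_apply hρ hρc hu, smul_eq_mul, smul_eq_mul]
  simp_rw [delAlong_ofReal_comp_sub hρ]
  have h1 := integrable_fderiv_comp_sub_mul hρ hρc hu x v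
  have h2 := integrable_fderiv_comp_sub_mul hρ hρc hu x (I • v)
  rw [← integral_const_mul, ← integral_sub h1 (h2.const_mul I), ← integral_const_mul, ← integral_neg]
  refine integral_congr_ae (ae_of_all _ fun y ↦ ?_)
  ring

/-! ### Commutation with weak first-order constant-coefficient relations -/

/-- **Mollification commutes with the weak `(0,1)`-form relation** (Friedrichs, constant
coefficients): if `∫ (F₂ ∂̄_a W - F₁ ∂̄_b W) dλ = -∫ S W dλ` for every complex test function `W`, then
`∂̄_a (ρ ⋆ F₂)(x) - ∂̄_b (ρ ⋆ F₁)(x) = (ρ ⋆ S)(x)` for every `x`.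
[cite: HormanderSCV1973, Lemma 4.1.3 (proof, p. 80–81)] -/
theorem dbarAlong_convolution_sub_eq {F₁ F₂ S : (ι → ℂ) → ℂ} (hF₁ : LocallyIntegrable F₁ volume)
    (hF₂ : LocallyIntegrable F₂ volume) (a b : ι → ℂ)
    (h : ∀ W : (ι → ℂ) → ℂ, ContDiff ℝ ∞ W → HasCompactSupport W →
      ∫ y, (F₂ y * dbarAlong a W y - F₁ y * dbarAlong b W y) = -∫ y, S y * W y)
    (hρ : ContDiff ℝ ∞ ρ) (hρc : HasCompactSupport ρ) (x : ι → ℂ) :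
    dbarAlong a (ρ ⋆[lsmul ℝ ℝ, volume] F₂) x - dbarAlong b (ρ ⋆[lsmul ℝ ℝ, volume] F₁) x =
      (ρ ⋆[lsmul ℝ ℝ, volume] S) x := by
  have hρ1 : ContDiff ℝ 1 ρ := hρ.of_le (by exact_mod_cast le_top)
  have hW : ContDiff ℝ ∞ fun y ↦ (ρ (x - y) : ℂ) := contDiff_ofReal_comp_sub hρ x
  have hWc : HasCompactSupport fun y ↦ (ρ (x - y) : ℂ) := hasCompactSupport_ofReal_comp_sub hρc x
  have key := h _ hW hWc
  have hW1 : ContDiff ℝ 1 fun y ↦ (ρ (x - y) : ℂ) := hW.of_le (by exact_mod_cast le_top)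
  have hi : ∀ {F : (ι → ℂ) → ℂ}, LocallyIntegrable F volume → ∀ v, Integrable (fun y ↦ F y *
      dbarAlong v (fun y ↦ (ρ (x - y) : ℂ)) y) volume := by
    intro F hF v
    have hc : ∀ w : ι → ℂ, Continuous fun y ↦ (fderiv ℝ ρ (x - y) w : ℂ) := fun w ↦
      continuous_ofReal.comp (((hρ1.continuous_fderiv one_ne_zero).comp (continuous_const.sub continuous_id)).clm_apply
        continuous_const)
    refine integrable_mul_of_hasCompactSupport hF ?_ ?_
    · exact ((continuous_const.mul ((hc v).add (continuous_const.mul (hc _)))).neg).congr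
        fun y ↦ (dbarAlong_ofReal_comp_sub hρ1 x y v).symm
    · exact (hWc.fderiv ℝ).mono fun y hy ↦ by
        rw [mem_support] at hy ⊢
        intro h0; apply hy
        rw [dbarAlong_apply, h0]; simp
  rw [dbarAlong_convolution hρ1 hρc hF₂, dbarAlong_convolution hρ1 hρc hF₁, convolution_eq_integral,
    neg_sub_neg, ← integral_sub (hi hF₁ b) (hi hF₂ a)]
  have : ∫ y, (F₁ y * dbarAlong b (fun y ↦ (ρ (x - y) : ℂ)) y - F₂ y * dbarAlong a (fun y ↦ (ρ (x - y) : ℂ)) y) =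
      -∫ y, (F₂ y * dbarAlong a (fun y ↦ (ρ (x - y) : ℂ)) y - F₁ y * dbarAlong b (fun y ↦ (ρ (x - y) : ℂ)) y) := by
    rw [← integral_neg]
    exact integral_congr_ae (ae_of_all _ fun y ↦ by ring)
  rw [this, key, neg_neg]

/-- **Mollification commutes with the weak divergence relation** (Friedrichs, constant
coefficients): if `∫ ∑_i F_i ∂_{v_i} W dλ = -∫ H W dλ` for every complex test function `W`, then
`∑_i ∂_{v_i} (ρ ⋆ F_i)(x) = (ρ ⋆ H)(x)` for every `x`.
[cite: HormanderSCV1973, Lemma 4.1.3 (proof, p. 80–81)] -/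
theorem sum_delAlong_convolution_eq {κ : Type*} [Fintype κ] {F : κ → (ι → ℂ) → ℂ} {H : (ι → ℂ) → ℂ}
    (hF : ∀ i, LocallyIntegrable (F i) volume) (v : κ → ι → ℂ)
    (h : ∀ W : (ι → ℂ) → ℂ, ContDiff ℝ ∞ W → HasCompactSupport W →
      ∫ y, ∑ i, F i y * delAlong (v i) W y = -∫ y, H y * W y)
    (hρ : ContDiff ℝ ∞ ρ) (hρc : HasCompactSupport ρ) (x : ι → ℂ) :
    ∑ i, delAlong (v i) (ρ ⋆[lsmul ℝ ℝ, volume] (F i)) x = (ρ ⋆[lsmul ℝ ℝ, volume] H) x := by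
  have hρ1 : ContDiff ℝ 1 ρ := hρ.of_le (by exact_mod_cast le_top)
  have hW : ContDiff ℝ ∞ fun y ↦ (ρ (x - y) : ℂ) := contDiff_ofReal_comp_sub hρ x
  have hWc : HasCompactSupport fun y ↦ (ρ (x - y) : ℂ) := hasCompactSupport_ofReal_comp_sub hρc x
  have key := h _ hW hWc
  have hi : ∀ i, Integrable (fun y ↦ F i y * delAlong (v i) (fun y ↦ (ρ (x - y) : ℂ)) y) volume := by
    intro i
    have hc : ∀ w : ι → ℂ, Continuous fun y ↦ (fderiv ℝ ρ (x - y) w : ℂ) := fun w ↦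
      continuous_ofReal.comp (((hρ1.continuous_fderiv one_ne_zero).comp (continuous_const.sub continuous_id)).clm_apply
        continuous_const)
    refine integrable_mul_of_hasCompactSupport (hF i) ?_ ?_
    · exact ((continuous_const.mul ((hc _).sub (continuous_const.mul (hc _)))).neg).congr
        fun y ↦ (delAlong_ofReal_comp_sub hρ1 x y (v i)).symm
    · exact (hWc.fderiv ℝ).mono fun y hy ↦ by
        rw [mem_support] at hy ⊢
        intro h0; apply hy
        rw [delAlong_apply, h0]; simp
  simp_rw [delAlong_convolution hρ1 hρc (hF _)]
  rw [Finset.sum_neg_distrib, ← integral_finsetSum _ fun i _ ↦ hi i, convolution_eq_integral]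
  have : ∫ y, ∑ i, F i y * delAlong (v i) (fun y ↦ (ρ (x - y) : ℂ)) y = -∫ y, H y * (ρ (x - y) : ℂ) := key
  rw [this, neg_neg]

/-! ### Support of the mollification -/

/-- Support of a mollification by a kernel supported in `closedBall 0 R`:
`support (ρ ⋆ u) ⊆ closedBall 0 R + tsupport u`, hence (for `u` supported in a compact `K`) in the
compact `R`-neighbourhood of `K`. [folklore] -/
theorem support_convolution_subset_cthickening {R : ℝ} (hρR : tsupport ρ ⊆ Metric.closedBall 0 R)
    (u : (ι → ℂ) → ℂ) : support (ρ ⋆[lsmul ℝ ℝ, volume] u) ⊆ Metric.cthickening R (tsupport u) := by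
  intro x hx
  have h1 := support_convolution_subset (L := lsmul ℝ ℝ) (μ := volume) (f := ρ) (g := u) hx
  obtain ⟨a, ha, b, hb, rfl⟩ := Set.mem_add.1 h1
  have ha' : ‖a‖ ≤ R := by
    have := hρR (subset_tsupport _ ha)
    rwa [Metric.mem_closedBall, dist_zero_right] at this
  rw [Metric.mem_cthickening_iff]
  refine le_trans (Metric.infEDist_le_edist_of_mem (subset_tsupport _ hb)) ?_
  rw [edist_dist, dist_eq_norm, add_sub_cancel_right]
  exact ENNReal.ofReal_le_ofReal ha'

/-- The `tsupport` version. [folklore] -/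
theorem tsupport_convolution_subset_cthickening {R : ℝ} (hρR : tsupport ρ ⊆ Metric.closedBall 0 R)
    (u : (ι → ℂ) → ℂ) : tsupport (ρ ⋆[lsmul ℝ ℝ, volume] u) ⊆ Metric.cthickening R (tsupport u) :=
  closure_minimal (support_convolution_subset_cthickening hρR u) Metric.isClosed_cthickening

end WirtingerMollification

end Literature.Analysis.Complex
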